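import Literature.NumberTheory.Automorphic.KimExteriorSquareGL4Lemmas
import Literature.NumberTheory.Automorphic.AutomorphicRepsGLSatakeFlathProofs
import HarnessLib

/-!
# Kim's exterior square lift `∧² : GL₄ → GL₆`: the algebra of `∧²` on Satake parameters and
# the form in which Theorem A is used

Sibling proof file (theorems only; no `sorry`, no named fact) of
`Literature.NumberTheory.Automorphic.KimExteriorSquareGL4`, whose named fact
`Kim2003_exteriorSquare_GL4` renders H. H. Kim, *Functoriality for the exterior square of `GL₄`
and the symmetric fourth of `GL₂`*, J. Amer. Math. Soc. **16** (2003) 139–183 [Kim2002],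
Theorem A (p. 139) = Thm. 5.3.1 (p. 165) in its weak (Satake) form — which is, word for word,
Kim's **Theorem 4.2.3** (p. 156): *"Let `π` be a cuspidal representation of `GL₄(𝔸_F)`. Then
there exists a weak exterior square lift `Π` of `GL₆(𝔸_F)`. It is of the form `τ₁ ⊞ ⋯ ⊞ τ_k` in
the notation of [J-S3], where `τᵢ` is a (unitary) cuspidal representation of `GL_{nᵢ}(𝔸_F)`"*
(weak lift: `Π_v ≃ ∧²π_v` for almost all `v`, Def. 2.2 p. 144 and Thm. 4.1.1 p. 153; at an
unramified `π_v = Ind(η₁ ⊗ η₂ ⊗ η₃ ⊗ η₄)`, `∧²π_v` is the unramified constituent of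
`Ind(η₁η₂ ⊗ η₁η₃ ⊗ η₁η₄ ⊗ η₂η₃ ⊗ η₂η₄ ⊗ η₃η₄)`, p. 152 — the tree's `wedgeTwoParams`).

## What is proved here

* The algebra of `wedgeTwoParams` (`{αᵢαⱼ : i < j}`) needed by every user of the fact and by the
  normalisation step of its proof: `wedgeTwoParams_zero/singleton/cons` (the explicit `n = 4`
  expansion `wedgeTwoParams_four` and the twist rule `wedgeTwoParams_map_mul`,
  `∧²(π ⊗ χ) = ∧²π ⊗ χ²` — the compatibility invoked in the module docstring of
  `KimExteriorSquareGL4` to pass between Kim's unitary normalisation and arbitrary cuspidal data —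
  are the ones of the imported companion file `KimExteriorSquareGL4Lemmas`, not restated here, so
  that both files can be imported together), the determinant rule `prod_wedgeTwoParams`
  (`det ∧²g = (det g)^{n-1}`; for `n = 4` this is Kim's remark "the central character of `Π` is
  `ω_Π = ω_π³`", p. 154), and the **essential self-duality** of `∧²` in rank `4`,
  `wedgeTwoParams_four_map_mul_inv` / `map_prod_mul_inv_wedgeTwoParams_of_card_eq_four`
  (`{(∏α)·(αᵢαⱼ)⁻¹} = {α_kα_l}`: `∧²π ≅ (∧²π)^∨ ⊗ ω_π` on Satake parameters — the image of
  `∧² : GL₄(ℂ) → GL₆(ℂ)` preserves the quadratic form `∧²ℂ⁴ ⊗ ∧²ℂ⁴ → ∧⁴ℂ⁴ = det` up to the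
  similitude `det`).
* `Kim2003_exteriorSquare_GL4.wedgeTwoParams_eq_sum` — **Theorem A in the form in which it is
  used** (Kim, §6, proof of Prop. 6.1, p. 165: "`L(s, σ ⊗ π, ρ_m ⊗ ∧²ρ₄) = L(s, σ × Π) =
  ∏ᵢ L(s, σ × τᵢ)`"): combining the two clauses of the fact through the *proved* uniqueness of
  Satake parameters (`AutomorphicRepData.hasSatakeParamAt_unique_holds`, Flath 1979 Thm. 3), for
  every cuspidal `π` on `GL₄(𝔸_F)` there are cuspidal `σᵢ` on `GL_{nᵢ}(𝔸_F)`, `∑ nᵢ = 6`, with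
  `∧² t_{π,v} = ⊎ᵢ t_{σᵢ,v}` at almost every finite place `v` — the identity of unramified Euler
  factors `L_v(s, π, ∧²) = ∏ᵢ L_v(s, σᵢ)` behind Prop. 6.1–6.3.
* `Kim2003_exteriorSquare_GL4.prod_sum_eq_pow_three` — at such places the product of the
  `σᵢ`-parameters is the cube of the product of the `π`-parameters (`ω_Π = ω_π³`, p. 154).
* **`∧²` and base change** (Kim, §4.2, proof of Thm. 4.2.3, p. 157 — the one step of the
  induction on `r(π)` that is a statement about Satake parameters): `wedgeTwoParams_map_monoidHom`
  / `_map_pow` / `_map_inv` (`∧²(α^f) = (∧²α)^f`: unramified base change, and the contragredient,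
  commute with `∧²`); `AutomorphicRepData.isNearlyEquivalent_of_wedgeTwoLift` (a weak exterior
  square lift is unique up to near-equivalence); `AutomorphicRepData.eventually_hasSatakeParamAt_*`
  and `AutomorphicRepData.isNearlyEquivalent_baseChange_wedgeTwoLift` (`(∧²π)_E ∼ ∧²(π_E)`: base
  change of a weak `∧²`-lift and a weak `∧²`-lift of a weak base change have the same Satake
  parameters almost everywhere, the relation (1.1) of Arthur–Clozel being the one of the tree's
  `exists_baseChange_cyclic` / `IsWeakBaseChangeLiftAE`), its tower form
  `…_baseChange_wedgeTwoLift_tower` (Kim's descent condition (DC) for `K_j, K_r ⊆ K_jK_r`), and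
  the corollary `Kim2003_exteriorSquare_GL4.baseChange_comm` under the named fact. The step
  "near-equivalence ⇒ isomorphism" (strong multiplicity one / Jacquet–Shalika) and the descent
  itself (Prop. 4.2.4–4.2.5) are not asserted.

## Status of the discharge `Kim2003_exteriorSquare_GL4_holds` (triage: XL — a theory)

The fact is the apex theorem of [Kim2002]; its printed proof (pp. 143–165) is: the converse
theorem of Cogdell–Piatetski-Shapiro for `GL_n` with a finite exceptional set `S`
(Thm. 2.1 [Co-PS1]); the Langlands–Shahidi method on `Spin(2n)` (`D_n − 3` case) for the
analytic continuation, functional equation, holomorphy after a highly ramified twist and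
boundedness in vertical strips of `L(s, σ ⊗ π, ρ_m ⊗ ∧²ρ₄)`, `m ≤ 4` (§3: Prop. 3.1–3.4,
Thm. 3.5 [Ge-Sh], Prop. 3.8); the local Langlands correspondence for `GL_n` ([H-T], [He2]) and
the equality of Langlands–Shahidi and Artin factors (Prop. 2.3 [Sh4], Prop. 4.1–4.2); the
classification of automorphic representations of `GL_n` ([J-S3], (4.1)) and the comparison of
Hecke conjugacy classes (Prop. 4.1.2–4.1.6, using [Ra2, Thm. A]); Henniart's solvable descent of
supercuspidals (Thm. 4.2.1 [He1]) with Arthur–Clozel base change and Ramakrishnan's descent for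
isobaric representations (Prop. 4.2.4–4.2.5, Appendix 1); and, for the strong lift, the local
lifts of §5.2 and strong multiplicity one (Thm. 5.3.1). Of these carriers the tree has, as named
facts only, Arthur–Clozel base change (`ArthurClozel1989_weakLifting_cuspidal`) and the local
Langlands correspondence (`localLanglands_gl`, on local fields, not connected to the adelic data
`AutomorphicRepData`); it has no converse theorem for `GL_n`, no Langlands–Shahidi (or
Rankin–Selberg `GL₆ × GL_m`) `L`-functions with their functional equations, no parabolically
induced / isobaric automorphic representations (Langlands' lemma realising constituents of
`Ind τ₁ ⊗ ⋯ ⊗ τ_k` by Eisenstein series), and no local components `π_v` of an adelic datum. No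
instance of the fact is provable before an automorphic representation of `GL₆(𝔸_F)` with
prescribed Hecke eigenvalues can be constructed; nothing in this file assumes the fact except
the two consequences named `Kim2003_exteriorSquare_GL4.*`, which take it as the hypothesis `h`.

## References

* [Kim2002] H. H. Kim, *Functoriality for the exterior square of GL₄ and the symmetric fourth
  of GL₂*, J. Amer. Math. Soc. 16 (2003), 139–183: Def. 2.2, Thm. 2.1, §3, Thm. 4.1.1, (4.1),
  Thm. 4.2.3, Thm. 5.3.1, Prop. 6.1.
* D. Flath, *Decomposition of representations into tensor products*, Corvallis 1979, Thm. 3.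
-/

noncomputable section

open scoped Classical MatrixGroups
open IsDedekindDomain NumberField

namespace Literature.NumberTheory.Automorphic

/-! ### The algebra of `∧²` on Satake parameters -/

/-- `∧²` of the empty parameter is empty. [folklore] -/
@[simp] theorem wedgeTwoParams_zero : wedgeTwoParams 0 = 0 := by
  simp [wedgeTwoParams]

/-- `∧²` of a one-element parameter is empty (`∧² : GL₁ → GL₀`). [folklore] -/
@[simp] theorem wedgeTwoParams_singleton (a : ℂ) : wedgeTwoParams {a} = 0 := by
  simp [wedgeTwoParams, Multiset.powersetCard_eq_empty]

/-- **Recursion for `∧²`.** Adjoining an eigenvalue `a` to `α` adds the products `a αⱼ` to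
`∧²α`: `∧²(a ⊕ α) = a·α ⊎ ∧²α` (the branching `∧²(L ⊕ V) = L ⊗ V ⊕ ∧²V`). [folklore] -/
theorem wedgeTwoParams_cons (a : ℂ) (α : Multiset ℂ) :
    wedgeTwoParams (a ::ₘ α) = α.map (a * ·) + wedgeTwoParams α := by
  simp only [wedgeTwoParams, Multiset.powersetCard_cons, Multiset.map_add, Multiset.powersetCard_one,
    Multiset.map_map, Function.comp_def, Multiset.prod_cons, Multiset.prod_singleton]
  exact add_comm _ _

-- `wedgeTwoParams_four` (`∧²{a, b, c, d} = {ad, ac, bd, cd, bc, ab}`, Kim 2003 p. 152) and the twist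
-- rule `wedgeTwoParams_map_mul` (`∧²(c·α) = c²·∧²α`) are provided by the imported
-- `KimExteriorSquareGL4Lemmas` (same namespace); they are used below under those names.

/-- **Determinant rule.** The product of `∧²α` is `(∏ α)^{n-1}` for `n = card α`
(`det ∧² g = (det g)^{n-1}`); for `n = 4`: `∏ ∧²α = (∏ α)³`, i.e. `ω_{∧²π} = ω_π³` (Kim 2003,
p. 154: "the central character of `Π` is `ω_Π = ω_π³`"). (For `α = 0` both sides are `1`.)
[cite: Kim2002, §4.1, p. 154] -/
theorem prod_wedgeTwoParams (α : Multiset ℂ) :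
    (wedgeTwoParams α).prod = α.prod ^ (Multiset.card α - 1) := by
  induction α using Multiset.induction_on with
  | empty => simp
  | cons a s ih =>
    rw [wedgeTwoParams_cons, Multiset.prod_add, ih, Multiset.prod_map_mul, Multiset.map_const',
      Multiset.prod_replicate, Multiset.map_id', Multiset.card_cons, Multiset.prod_cons,
      Nat.add_sub_cancel, mul_pow]
    rcases eq_or_ne s 0 with rfl | hs
    · simp
    · obtain ⟨k, hk⟩ := Nat.exists_eq_succ_of_ne_zero (Multiset.card_pos.mpr hs).ne'
      rw [hk, Nat.succ_sub_one, mul_assoc, ← pow_succ']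

/-- For a `GL₄` parameter (`card α = 4`): `∏ ∧²α = (∏ α)³`. [cite: Kim2002, §4.1, p. 154] -/
theorem prod_wedgeTwoParams_of_card_eq_four {α : Multiset ℂ} (hα : Multiset.card α = 4) :
    (wedgeTwoParams α).prod = α.prod ^ 3 := by
  rw [prod_wedgeTwoParams, hα]

/-! ### Essential self-duality of `∧²` in rank `4` -/

/-- **Essential self-duality of `∧²` on `GL₄`, explicitly.** For non-zero `a, b, c, d`, the map
`x ↦ abcd · x⁻¹` permutes `∧²{a, b, c, d} = {αᵢαⱼ : i < j}` (it exchanges `αᵢαⱼ` with the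
complementary product `α_kα_l`): on Satake parameters, `∧²π_v ≅ (∧²π_v)^∨ ⊗ ω_{π_v}` — the
exterior square of a `4`-dimensional representation is self-dual up to the twist by its
determinant (the pairing `∧²V ⊗ ∧²V → ∧⁴V = det V`), i.e. `∧² : GL₄(ℂ) → GL₆(ℂ)` lands in the
orthogonal similitude group `GO₆(ℂ)`. [folklore] -/
theorem wedgeTwoParams_four_map_mul_inv (a b c d : ℂ) (ha : a ≠ 0) (hb : b ≠ 0) (hc : c ≠ 0)
    (hd : d ≠ 0) :
    (wedgeTwoParams {a, b, c, d}).map (fun x ↦ a * b * c * d * x⁻¹) =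
      wedgeTwoParams {a, b, c, d} := by
  have h1 : a * b * c * d * (a * d)⁻¹ = b * c := by
    rw [mul_inv_eq_iff_eq_mul₀ (mul_ne_zero ha hd)]; ring
  have h2 : a * b * c * d * (a * c)⁻¹ = b * d := by
    rw [mul_inv_eq_iff_eq_mul₀ (mul_ne_zero ha hc)]; ring
  have h3 : a * b * c * d * (b * d)⁻¹ = a * c := by
    rw [mul_inv_eq_iff_eq_mul₀ (mul_ne_zero hb hd)]; ring
  have h4 : a * b * c * d * (c * d)⁻¹ = a * b := by
    rw [mul_inv_eq_iff_eq_mul₀ (mul_ne_zero hc hd)]; ring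
  have h5 : a * b * c * d * (b * c)⁻¹ = a * d := by
    rw [mul_inv_eq_iff_eq_mul₀ (mul_ne_zero hb hc)]; ring
  have h6 : a * b * c * d * (a * b)⁻¹ = c * d := by
    rw [mul_inv_eq_iff_eq_mul₀ (mul_ne_zero ha hb)]; ring
  rw [wedgeTwoParams_four]
  simp only [Multiset.insert_eq_cons, Multiset.map_cons, Multiset.map_singleton, h1, h2, h3, h4,
    h5, h6]
  simp only [← Multiset.singleton_add]
  abel

/-- **Essential self-duality of `∧²` on `GL₄`** (multiset form): for a `GL₄` parameter `α`
(`card α = 4`) without zero entry — every Satake parameter of an automorphic representation is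
such (`hasSatakeParamAt_ne_zero`, Cartier 1979 §IV.2) — `{(∏ α) · x⁻¹ : x ∈ ∧²α} = ∧²α`, i.e.
`∧²t ≅ (∧²t)^∨ ⊗ det t`: the Satake parameter of a weak exterior square lift `Π` of `π` is stable
under `x ↦ ω_π(ϖ_v) x⁻¹` (`Π ≅ Π̃ ⊗ ω_π` at almost every place). [folklore] -/
theorem map_prod_mul_inv_wedgeTwoParams_of_card_eq_four {α : Multiset ℂ}
    (hα : Multiset.card α = 4) (h0 : (0 : ℂ) ∉ α) :
    (wedgeTwoParams α).map (fun x ↦ α.prod * x⁻¹) = wedgeTwoParams α := by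
  induction α using Quotient.inductionOn with
  | h l =>
    simp only [Multiset.quot_mk_to_coe, Multiset.coe_card, Multiset.mem_coe] at hα h0 ⊢
    obtain ⟨a, b, c, d, rfl⟩ : ∃ a b c d, l = [a, b, c, d] := by
      rcases l with _ | ⟨a, _ | ⟨b, _ | ⟨c, _ | ⟨d, _ | ⟨e, l⟩⟩⟩⟩⟩ <;>
        simp only [List.length_cons, List.length_nil] at hα <;> (try omega)
      exact ⟨a, b, c, d, rfl⟩
    simp only [List.mem_cons, List.not_mem_nil, or_false, not_or] at h0
    obtain ⟨ha, hb, hc, hd⟩ := h0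
    have hcoe : ([a, b, c, d] : Multiset ℂ) = {a, b, c, d} := rfl
    rw [hcoe]
    simpa only [Multiset.insert_eq_cons, Multiset.prod_cons, Multiset.prod_singleton, mul_assoc]
      using wedgeTwoParams_four_map_mul_inv a b c d (Ne.symm ha) (Ne.symm hb) (Ne.symm hc)
        (Ne.symm hd)

/-! ### Theorem A in the form in which it is used -/

/-- **Kim's Theorem A, as used** (Kim 2003, proof of Prop. 6.1, p. 165:
"`L(s, σ ⊗ π, ρ_m ⊗ ∧²ρ₄) = L(s, σ × Π) = ∏ᵢ L(s, σ × τᵢ)`"). Under the named fact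
`Kim2003_exteriorSquare_GL4`, for every cuspidal `π` on `GL₄(𝔸_F)` there are cuspidal `σᵢ` on
`GL_{nᵢ}(𝔸_F)` (`i < k`, `∑ nᵢ = 6`) such that at almost every finite place `v`: whenever `π`
has Satake parameter `α` at `v` and the `σᵢ` have Satake parameters `βᵢ` at `v`, then
`∧²α = ⊎ᵢ βᵢ` — equivalently `L_v(s, π, ∧²) = ∏ᵢ L_v(s, σᵢ)`. Obtained from the two clauses of
the fact (both about the same automorphic `Π` on `GL₆(𝔸_F)`) and the uniqueness of Satake
parameters of `Π`, which is a theorem of the tree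
(`AutomorphicRepData.hasSatakeParamAt_unique_holds`; Flath 1979, Thm. 3).
[cite: Kim2002, Thm. 4.2.3 (p. 156) and proof of Prop. 6.1 (p. 165)] -/
theorem Kim2003_exteriorSquare_GL4.wedgeTwoParams_eq_sum (h : Kim2003_exteriorSquare_GL4)
    (F : Type) [Field F] [NumberField F] (hF : ∀ m : ℕ, isCompact_glFiniteIntegralLevel m F)
    (π : CuspidalAutomorphicRepData 4 F (hF 4)) :
    ∃ (k : ℕ) (m : Fin k → ℕ) (σ : ∀ i : Fin k, CuspidalAutomorphicRepData (m i) F (hF (m i))),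
      (∑ i, m i = 6) ∧
      ∀ᶠ v : HeightOneSpectrum (𝓞 F) in Filter.cofinite,
        ∀ (α : Multiset ℂ) (β : Fin k → Multiset ℂ),
          π.1.HasSatakeParamAt v α → (∀ i, (σ i).1.HasSatakeParamAt v (β i)) →
            wedgeTwoParams α = ∑ i, β i := by
  obtain ⟨P, hP, k, m, σ, hm, hσ⟩ := h F hF π
  refine ⟨k, m, σ, hm, ?_⟩
  filter_upwards [hP, hσ] with v h₁ h₂ α β hα hβ
  exact AutomorphicRepData.hasSatakeParamAt_unique_holds P (h₁ α hα) (h₂ β hβ)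

/-- **`ω_Π = ω_π³` on Satake parameters** (Kim 2003, p. 154). Under the named fact, with the
`σᵢ` of `Kim2003_exteriorSquare_GL4.wedgeTwoParams_eq_sum`: at almost every finite `v`, the
product of all the `σᵢ`-parameters is the cube of the product of the `π`-parameter
(`prod_wedgeTwoParams_of_card_eq_four`; a Satake parameter of `GL₄` has four entries,
`HasSatakeParamAt.card_eq`). [cite: Kim2002, §4.1, p. 154] -/
theorem Kim2003_exteriorSquare_GL4.prod_sum_eq_pow_three (h : Kim2003_exteriorSquare_GL4)
    (F : Type) [Field F] [NumberField F] (hF : ∀ m : ℕ, isCompact_glFiniteIntegralLevel m F)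
    (π : CuspidalAutomorphicRepData 4 F (hF 4)) :
    ∃ (k : ℕ) (m : Fin k → ℕ) (σ : ∀ i : Fin k, CuspidalAutomorphicRepData (m i) F (hF (m i))),
      (∑ i, m i = 6) ∧
      ∀ᶠ v : HeightOneSpectrum (𝓞 F) in Filter.cofinite,
        ∀ (α : Multiset ℂ) (β : Fin k → Multiset ℂ),
          π.1.HasSatakeParamAt v α → (∀ i, (σ i).1.HasSatakeParamAt v (β i)) →
            (∑ i, β i).prod = α.prod ^ 3 := by
  obtain ⟨k, m, σ, hm, hv⟩ := h.wedgeTwoParams_eq_sum F hF π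
  refine ⟨k, m, σ, hm, ?_⟩
  filter_upwards [hv] with v hv α β hα hβ
  rw [← hv α β hα hβ, prod_wedgeTwoParams_of_card_eq_four hα.card_eq]


/-! ### `∧²` and base change on Satake parameters (Kim 2003, §4.2, proof of Thm. 4.2.3) -/

section BaseChange

/-- `∧²` commutes with every multiplicative map of the parameters: for a monoid homomorphism
`φ : ℂ →* ℂ`, `∧²(φ_* α) = φ_*(∧² α)` (`φ(αᵢαⱼ) = φ(αᵢ)φ(αⱼ)`). [folklore] -/
theorem wedgeTwoParams_map_monoidHom (φ : ℂ →* ℂ) (α : Multiset ℂ) :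
    wedgeTwoParams (α.map φ) = (wedgeTwoParams α).map φ := by
  simp only [wedgeTwoParams, Multiset.powersetCard_map, Multiset.map_map, Function.comp_def,
    map_multiset_prod]

/-- **Unramified base change commutes with `∧²` on Satake parameters**: `∧²(α^f) = (∧²α)^f`,
where `α^f = α.map (· ^ f)` is the Satake parameter at a place `w` of residue degree `f = f(w|v)`
of the base change of an unramified `π_v` with parameter `α` (Arthur–Clozel 1989, Ch. 3, (1.1);
the relation of the tree's `exists_baseChange_cyclic` and `IsWeakBaseChangeLiftAE`). This is the
unramified computation behind Kim 2003, proof of Thm. 4.2.3, p. 157: at a place `w` of `K_jK_r`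
above `v`, both `((Π_j)_{K_jK_r})_w` and `((Π_r)_{K_jK_r})_w` "correspond to the restriction (to
the Weil group of `(K_jK_r)_w`) of `∧²φ_v`". [cite: Kim2002, §4.2, proof of Thm. 4.2.3, p. 157] -/
theorem wedgeTwoParams_map_pow (α : Multiset ℂ) (f : ℕ) :
    wedgeTwoParams (α.map (· ^ f)) = (wedgeTwoParams α).map (· ^ f) :=
  wedgeTwoParams_map_monoidHom (powMonoidHom f) α

/-- **`∧²` commutes with the contragredient on Satake parameters**: `∧²(α⁻¹) = (∧²α)⁻¹`
(`t_{π̃,v} = t_{π,v}⁻¹`; Kim 2003 uses `∧²π̃ = (∧²π)~` throughout §§2, 5). [folklore] -/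
theorem wedgeTwoParams_map_inv (α : Multiset ℂ) :
    wedgeTwoParams (α.map (·⁻¹)) = (wedgeTwoParams α).map (·⁻¹) :=
  wedgeTwoParams_map_monoidHom invMonoidHom α

variable {F E : Type} [Field F] [NumberField F] [Field E] [NumberField E] [Algebra F E]

/-- Cofinite pull-back along `w ↦ w ∩ 𝓞 F` from the finite places of `F` to those of an
extension `E`: the places of `E` above a given place of `F` form a finite set (Mathlib
`IsDedekindDomain.primesOver_finite`), so a property of almost all `v` holds at the place below
almost all `w`. (Same content as `finite_setOf_asIdeal_under_eq` of `BaseChangeInductionAlong`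
and `tendsto_under_cofinite` of `Sweep1Proofs`; repeated to keep this file's imports as they
are.) [folklore] -/
theorem eventually_cofinite_forall_under_eq {p : HeightOneSpectrum (𝓞 F) → Prop}
    (h : ∀ᶠ v : HeightOneSpectrum (𝓞 F) in Filter.cofinite, p v) :
    ∀ᶠ w : HeightOneSpectrum (𝓞 E) in Filter.cofinite,
      ∀ v : HeightOneSpectrum (𝓞 F), w.asIdeal.under (𝓞 F) = v.asIdeal → p v := by
  rw [Filter.eventually_cofinite] at h ⊢
  have hfib : ∀ v : HeightOneSpectrum (𝓞 F),
      {w : HeightOneSpectrum (𝓞 E) | w.asIdeal.under (𝓞 F) = v.asIdeal}.Finite := by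
    intro v
    have hfin := IsDedekindDomain.primesOver_finite v.asIdeal (𝓞 E)
    refine (hfin.preimage (f := fun w : HeightOneSpectrum (𝓞 E) => w.asIdeal)
      fun _ _ _ _ h => HeightOneSpectrum.ext h).subset ?_
    intro w hw
    have hw' : w.asIdeal.under (𝓞 F) = v.asIdeal := hw
    exact ⟨w.isPrime, ⟨hw'.symm⟩⟩
  refine (h.biUnion fun v _ => hfib v).subset ?_
  intro w hw
  simp only [Set.mem_setOf_eq, not_forall] at hw
  obtain ⟨v, hv, hpv⟩ := hw
  exact Set.mem_biUnion hpv hv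

/-- **Near-equivalence from a common recipe.** If the Satake parameters of two automorphic
representations `B₁, B₂` of `GL_m(𝔸_E)` at almost every finite place `w` are the same function
`γ_w` of a Satake parameter of a fixed automorphic `π` on `GL_n(𝔸_F)` at the place `v` of
`F ⊆ E` below `w`, then `B₁` and `B₂` are nearly equivalent (`IsNearlyEquivalent`: a common
Satake parameter at almost every `w`) — because `π` *has* a Satake parameter at almost every `v`
(`AutomorphicRepData.hasSatakeParamAt_cofinite_holds`, Flath 1979, Thm. 3). This is the formal
shape of "both local representations correspond to (a functorial image of) `φ_v`, hence are
isomorphic" (Kim 2003, p. 157), after which strong multiplicity one is invoked. [folklore] -/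
theorem AutomorphicRepData.isNearlyEquivalent_of_forall_under_eq {n m : ℕ}
    {hFn : isCompact_glFiniteIntegralLevel n F} {hEm : isCompact_glFiniteIntegralLevel m E}
    (π : AutomorphicRepData (AutomorphyDatum.gl n F hFn))
    (γ : HeightOneSpectrum (𝓞 E) → Multiset ℂ → Multiset ℂ)
    {B₁ B₂ : AutomorphicRepData (AutomorphyDatum.gl m E hEm)}
    (h₁ : ∀ᶠ w : HeightOneSpectrum (𝓞 E) in Filter.cofinite,
      ∀ (v : HeightOneSpectrum (𝓞 F)) (α : Multiset ℂ), w.asIdeal.under (𝓞 F) = v.asIdeal →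
        π.HasSatakeParamAt v α → B₁.HasSatakeParamAt w (γ w α))
    (h₂ : ∀ᶠ w : HeightOneSpectrum (𝓞 E) in Filter.cofinite,
      ∀ (v : HeightOneSpectrum (𝓞 F)) (α : Multiset ℂ), w.asIdeal.under (𝓞 F) = v.asIdeal →
        π.HasSatakeParamAt v α → B₂.HasSatakeParamAt w (γ w α)) :
    B₁.IsNearlyEquivalent B₂ := by
  have hπ := eventually_cofinite_forall_under_eq (E := E) π.hasSatakeParamAt_cofinite_holds
  filter_upwards [h₁, h₂, hπ] with w h₁ h₂ hπ
  have hv : w.asIdeal.under (𝓞 F) = (w.under (𝓞 F)).asIdeal := by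
    rw [HeightOneSpectrum.under_asIdeal]
  obtain ⟨α, hα⟩ := hπ _ hv
  exact ⟨γ w α, h₁ _ α hv hα, h₂ _ α hv hα⟩

variable {hF4 : isCompact_glFiniteIntegralLevel 4 F} {hF6 : isCompact_glFiniteIntegralLevel 6 F}
  {hE4 : isCompact_glFiniteIntegralLevel 4 E} {hE6 : isCompact_glFiniteIntegralLevel 6 E}

/-- **A weak exterior square lift is unique up to near-equivalence**: two automorphic `Π₁, Π₂`
on `GL₆(𝔸_F)` with `t_{Πᵢ,v} = ∧² t_{π,v}` for almost all `v` (clause (i) of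
`Kim2003_exteriorSquare_GL4`; Kim 2003, Def. 2.2) have the same Satake parameters almost
everywhere (so, being of the form `τ₁ ⊞ ⋯ ⊞ τ_k`, they are equivalent by the classification
theorem of Jacquet–Shalika — not asserted here). [cite: Kim2002, Def. 2.2 (p. 144)] -/
theorem AutomorphicRepData.isNearlyEquivalent_of_wedgeTwoLift
    (π : AutomorphicRepData (AutomorphyDatum.gl 4 F hF4))
    {P₁ P₂ : AutomorphicRepData (AutomorphyDatum.gl 6 F hF6)}
    (h₁ : ∀ᶠ v : HeightOneSpectrum (𝓞 F) in Filter.cofinite, ∀ α : Multiset ℂ,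
      π.HasSatakeParamAt v α → P₁.HasSatakeParamAt v (wedgeTwoParams α))
    (h₂ : ∀ᶠ v : HeightOneSpectrum (𝓞 F) in Filter.cofinite, ∀ α : Multiset ℂ,
      π.HasSatakeParamAt v α → P₂.HasSatakeParamAt v (wedgeTwoParams α)) :
    P₁.IsNearlyEquivalent P₂ := by
  filter_upwards [h₁, h₂, π.hasSatakeParamAt_cofinite_holds] with v h₁ h₂ hπ
  obtain ⟨α, hα⟩ := hπ
  exact ⟨wedgeTwoParams α, h₁ α hα, h₂ α hα⟩

/-- **Base change after `∧²`.** If `Π` is a weak exterior square lift of `π` over `F` and `B` is a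
weak base change of `Π` to `E` (relation (1.1) of Arthur–Clozel: `t_{B,w} = t_{Π,v}^{f(w|v)}`, the
shape of `exists_baseChange_cyclic` / `IsWeakBaseChangeLiftAE`), then for almost all `w`:
`t_{B,w} = (∧² t_{π,v})^{f(w|v)}`. [cite: Kim2002, §4.2, proof of Thm. 4.2.3, p. 157] -/
theorem AutomorphicRepData.eventually_hasSatakeParamAt_baseChange_of_wedgeTwoLift
    (π : AutomorphicRepData (AutomorphyDatum.gl 4 F hF4))
    (P : AutomorphicRepData (AutomorphyDatum.gl 6 F hF6))
    (B : AutomorphicRepData (AutomorphyDatum.gl 6 E hE6))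
    (hP : ∀ᶠ v : HeightOneSpectrum (𝓞 F) in Filter.cofinite, ∀ α : Multiset ℂ,
      π.HasSatakeParamAt v α → P.HasSatakeParamAt v (wedgeTwoParams α))
    (hB : ∀ᶠ w : HeightOneSpectrum (𝓞 E) in Filter.cofinite,
      ∀ (v : HeightOneSpectrum (𝓞 F)) (β : Multiset ℂ), w.asIdeal.under (𝓞 F) = v.asIdeal →
        P.HasSatakeParamAt v β →
          B.HasSatakeParamAt w (β.map (· ^ w.asIdeal.inertiaDeg (𝓞 F)))) :
    ∀ᶠ w : HeightOneSpectrum (𝓞 E) in Filter.cofinite,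
      ∀ (v : HeightOneSpectrum (𝓞 F)) (α : Multiset ℂ), w.asIdeal.under (𝓞 F) = v.asIdeal →
        π.HasSatakeParamAt v α →
          B.HasSatakeParamAt w ((wedgeTwoParams α).map (· ^ w.asIdeal.inertiaDeg (𝓞 F))) := by
  filter_upwards [hB, eventually_cofinite_forall_under_eq (E := E) hP] with w hB hP v α hv hα
  exact hB v _ hv (hP v hv α hα)

/-- **`∧²` after base change.** If `π_E` is a weak base change of `π` to `E`
(`t_{π_E,w} = t_{π,v}^{f(w|v)}`) and `Π'` is a weak exterior square lift of `π_E` over `E`, then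
for almost all `w`: `t_{Π',w} = ∧²(t_{π,v}^{f}) = (∧² t_{π,v})^{f}` (`wedgeTwoParams_map_pow`).
[cite: Kim2002, §4.2, proof of Thm. 4.2.3, p. 157] -/
theorem AutomorphicRepData.eventually_hasSatakeParamAt_wedgeTwoLift_of_baseChange
    (π : AutomorphicRepData (AutomorphyDatum.gl 4 F hF4))
    (πE : AutomorphicRepData (AutomorphyDatum.gl 4 E hE4))
    (P' : AutomorphicRepData (AutomorphyDatum.gl 6 E hE6))
    (hπE : ∀ᶠ w : HeightOneSpectrum (𝓞 E) in Filter.cofinite,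
      ∀ (v : HeightOneSpectrum (𝓞 F)) (α : Multiset ℂ), w.asIdeal.under (𝓞 F) = v.asIdeal →
        π.HasSatakeParamAt v α → πE.HasSatakeParamAt w (α.map (· ^ w.asIdeal.inertiaDeg (𝓞 F))))
    (hP' : ∀ᶠ w : HeightOneSpectrum (𝓞 E) in Filter.cofinite, ∀ β : Multiset ℂ,
      πE.HasSatakeParamAt w β → P'.HasSatakeParamAt w (wedgeTwoParams β)) :
    ∀ᶠ w : HeightOneSpectrum (𝓞 E) in Filter.cofinite,
      ∀ (v : HeightOneSpectrum (𝓞 F)) (α : Multiset ℂ), w.asIdeal.under (𝓞 F) = v.asIdeal →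
        π.HasSatakeParamAt v α →
          P'.HasSatakeParamAt w ((wedgeTwoParams α).map (· ^ w.asIdeal.inertiaDeg (𝓞 F))) := by
  filter_upwards [hπE, hP'] with w h₁ h₂ v α hv hα
  rw [← wedgeTwoParams_map_pow]
  exact h₂ _ (h₁ v α hv hα)

/-- **The weak exterior square lift commutes with weak base change** (Kim 2003, proof of
Thm. 4.2.3, p. 157, Satake form). Let `π` be automorphic on `GL₄(𝔸_F)` with a weak exterior
square lift `Π` on `GL₆(𝔸_F)`, let `π_E` be a weak base change of `π` to a finite extension
`E ⊇ F` and `Π'` a weak exterior square lift of `π_E` on `GL₆(𝔸_E)`. Then every weak base change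
`B` of `Π` to `E` is nearly equivalent to `Π'`: `(∧²π)_E ∼ ∧²(π_E)` — at almost every finite place
`w` of `E` both have the Satake parameter `(∧² t_{π,v})^{f(w|v)}`, `v` the place below `w` (Kim:
"by construction, both of these local representations correspond to the restriction … of `∧²φ_v`
… Hence the strong multiplicity one theorem gives (DC)"; the passage from near-equivalence to
isomorphism, strong multiplicity one / Jacquet–Shalika, is not asserted here).
[cite: Kim2002, §4.2, proof of Thm. 4.2.3, p. 157] -/
theorem AutomorphicRepData.isNearlyEquivalent_baseChange_wedgeTwoLift
    (π : AutomorphicRepData (AutomorphyDatum.gl 4 F hF4))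
    (P : AutomorphicRepData (AutomorphyDatum.gl 6 F hF6))
    (πE : AutomorphicRepData (AutomorphyDatum.gl 4 E hE4))
    (P' B : AutomorphicRepData (AutomorphyDatum.gl 6 E hE6))
    (hP : ∀ᶠ v : HeightOneSpectrum (𝓞 F) in Filter.cofinite, ∀ α : Multiset ℂ,
      π.HasSatakeParamAt v α → P.HasSatakeParamAt v (wedgeTwoParams α))
    (hB : ∀ᶠ w : HeightOneSpectrum (𝓞 E) in Filter.cofinite,
      ∀ (v : HeightOneSpectrum (𝓞 F)) (β : Multiset ℂ), w.asIdeal.under (𝓞 F) = v.asIdeal →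
        P.HasSatakeParamAt v β →
          B.HasSatakeParamAt w (β.map (· ^ w.asIdeal.inertiaDeg (𝓞 F))))
    (hπE : ∀ᶠ w : HeightOneSpectrum (𝓞 E) in Filter.cofinite,
      ∀ (v : HeightOneSpectrum (𝓞 F)) (α : Multiset ℂ), w.asIdeal.under (𝓞 F) = v.asIdeal →
        π.HasSatakeParamAt v α → πE.HasSatakeParamAt w (α.map (· ^ w.asIdeal.inertiaDeg (𝓞 F))))
    (hP' : ∀ᶠ w : HeightOneSpectrum (𝓞 E) in Filter.cofinite, ∀ β : Multiset ℂ,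
      πE.HasSatakeParamAt w β → P'.HasSatakeParamAt w (wedgeTwoParams β)) :
    B.IsNearlyEquivalent P' :=
  AutomorphicRepData.isNearlyEquivalent_of_forall_under_eq π
    (fun w α ↦ (wedgeTwoParams α).map (· ^ w.asIdeal.inertiaDeg (𝓞 F)))
    (AutomorphicRepData.eventually_hasSatakeParamAt_baseChange_of_wedgeTwoLift π P B hP hB)
    (AutomorphicRepData.eventually_hasSatakeParamAt_wedgeTwoLift_of_baseChange π πE P' hπE hP')

/-- **Kim's descent condition (DC) on Satake parameters, in a tower `F ⊆ K ⊆ L`.** If `π_K`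
is a weak base change of `π` to `K`, `P_K` a weak exterior square lift of `π_K` over `K`, and `B`
a weak base change of `P_K` to `L`, then at almost every finite place `w` of `L`:
`t_{B,w} = (∧² t_{π,v})^{f(w|v)}`, `v` the place of `F` below `w` (`f(w|v) = f(w|u) f(u|v)`,
Mathlib `Ideal.inertiaDeg_tower`, and `wedgeTwoParams_map_pow`). Hence for two intermediate
fields `K_j, K_r ⊆ L = K_jK_r` the representations `(Π_j)_L` and `(Π_r)_L` have the same Satake
parameters almost everywhere (`AutomorphicRepData.isNearlyEquivalent_of_forall_under_eq` with
`γ_w(α) = (∧²α)^{f(w|v)}`) — Kim's verification of (DC), p. 157: "both of these local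
representations correspond to the restriction (to the Weil group of `(K_jK_r)_w`) of `∧²φ_v` …
Hence the strong multiplicity one theorem gives (DC)" (the last step is not asserted here).
[cite: Kim2002, §4.2, proof of Thm. 4.2.3, p. 157] -/
theorem AutomorphicRepData.eventually_hasSatakeParamAt_baseChange_wedgeTwoLift_tower
    {K L : Type} [Field K] [NumberField K] [Field L] [NumberField L] [Algebra F K] [Algebra K L]
    [Algebra F L] [IsScalarTower F K L] {hK4 : isCompact_glFiniteIntegralLevel 4 K}
    {hK6 : isCompact_glFiniteIntegralLevel 6 K} {hL6 : isCompact_glFiniteIntegralLevel 6 L}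
    (π : AutomorphicRepData (AutomorphyDatum.gl 4 F hF4))
    (πK : AutomorphicRepData (AutomorphyDatum.gl 4 K hK4))
    (PK : AutomorphicRepData (AutomorphyDatum.gl 6 K hK6))
    (B : AutomorphicRepData (AutomorphyDatum.gl 6 L hL6))
    (hπK : ∀ᶠ u : HeightOneSpectrum (𝓞 K) in Filter.cofinite,
      ∀ (v : HeightOneSpectrum (𝓞 F)) (α : Multiset ℂ), u.asIdeal.under (𝓞 F) = v.asIdeal →
        π.HasSatakeParamAt v α → πK.HasSatakeParamAt u (α.map (· ^ u.asIdeal.inertiaDeg (𝓞 F))))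
    (hPK : ∀ᶠ u : HeightOneSpectrum (𝓞 K) in Filter.cofinite, ∀ β : Multiset ℂ,
      πK.HasSatakeParamAt u β → PK.HasSatakeParamAt u (wedgeTwoParams β))
    (hB : ∀ᶠ w : HeightOneSpectrum (𝓞 L) in Filter.cofinite,
      ∀ (u : HeightOneSpectrum (𝓞 K)) (β : Multiset ℂ), w.asIdeal.under (𝓞 K) = u.asIdeal →
        PK.HasSatakeParamAt u β →
          B.HasSatakeParamAt w (β.map (· ^ w.asIdeal.inertiaDeg (𝓞 K)))) :
    ∀ᶠ w : HeightOneSpectrum (𝓞 L) in Filter.cofinite,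
      ∀ (v : HeightOneSpectrum (𝓞 F)) (α : Multiset ℂ), w.asIdeal.under (𝓞 F) = v.asIdeal →
        π.HasSatakeParamAt v α →
          B.HasSatakeParamAt w ((wedgeTwoParams α).map (· ^ w.asIdeal.inertiaDeg (𝓞 F))) := by
  have h1 := AutomorphicRepData.eventually_hasSatakeParamAt_wedgeTwoLift_of_baseChange
    π πK PK hπK hPK
  filter_upwards [hB, eventually_cofinite_forall_under_eq (E := L) h1] with w hB h1 v α hv hα
  have huv : (w.under (𝓞 K)).asIdeal.under (𝓞 F) = v.asIdeal := by
    rw [← hv, HeightOneSpectrum.under_asIdeal, Ideal.under_under]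
  have hB' := hB (w.under (𝓞 K)) _ rfl (h1 (w.under (𝓞 K)) rfl v α huv hα)
  have e : ((wedgeTwoParams α).map (· ^ (w.under (𝓞 K)).asIdeal.inertiaDeg (𝓞 F))).map
      (· ^ w.asIdeal.inertiaDeg (𝓞 K)) =
        (wedgeTwoParams α).map (· ^ w.asIdeal.inertiaDeg (𝓞 F)) := by
    rw [Multiset.map_map]
    refine Multiset.map_congr rfl fun x _ => ?_
    haveI : w.asIdeal.LiesOver (w.under (𝓞 K)).asIdeal := ⟨rfl⟩
    rw [Function.comp_apply, ← pow_mul, ← Ideal.inertiaDeg_tower]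
  rw [e] at hB'
  exact hB'

/-- **Kim's induction step on Satake parameters** (proof of Thm. 4.2.3, p. 157: "Let `π_{K_j}`
be the base change of `π` to `K_j` … we can assume that `π_{K_j}` is cuspidal … Let `Π_j` be a
weak exterior square lift of `π_{K_j}`"). Under the named fact `Kim2003_exteriorSquare_GL4`: if
`π` is cuspidal on `GL₄(𝔸_F)` and `π_E` is a *cuspidal* weak base change of `π` to `E ⊇ F`, then
the exterior square lifts `Π` of `π` (over `F`) and `Π'` of `π_E` (over `E`) given by the fact
are compatible with base change: every weak base change of `Π` to `E` is nearly equivalent to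
`Π'`. [cite: Kim2002, §4.2, proof of Thm. 4.2.3, p. 157] -/
theorem Kim2003_exteriorSquare_GL4.baseChange_comm (h : Kim2003_exteriorSquare_GL4)
    (F E : Type) [Field F] [NumberField F] [Field E] [NumberField E] [Algebra F E]
    (hF : ∀ m : ℕ, isCompact_glFiniteIntegralLevel m F)
    (hE : ∀ m : ℕ, isCompact_glFiniteIntegralLevel m E)
    (π : CuspidalAutomorphicRepData 4 F (hF 4)) (πE : CuspidalAutomorphicRepData 4 E (hE 4))
    (hπE : ∀ᶠ w : HeightOneSpectrum (𝓞 E) in Filter.cofinite,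
      ∀ (v : HeightOneSpectrum (𝓞 F)) (α : Multiset ℂ), w.asIdeal.under (𝓞 F) = v.asIdeal →
        π.1.HasSatakeParamAt v α →
          πE.1.HasSatakeParamAt w (α.map (· ^ w.asIdeal.inertiaDeg (𝓞 F)))) :
    ∃ (P : AutomorphicRepData (AutomorphyDatum.gl 6 F (hF 6)))
      (P' : AutomorphicRepData (AutomorphyDatum.gl 6 E (hE 6))),
      (∀ᶠ v : HeightOneSpectrum (𝓞 F) in Filter.cofinite, ∀ α : Multiset ℂ,
        π.1.HasSatakeParamAt v α → P.HasSatakeParamAt v (wedgeTwoParams α)) ∧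
      (∀ᶠ w : HeightOneSpectrum (𝓞 E) in Filter.cofinite, ∀ β : Multiset ℂ,
        πE.1.HasSatakeParamAt w β → P'.HasSatakeParamAt w (wedgeTwoParams β)) ∧
      ∀ B : AutomorphicRepData (AutomorphyDatum.gl 6 E (hE 6)),
        (∀ᶠ w : HeightOneSpectrum (𝓞 E) in Filter.cofinite,
          ∀ (v : HeightOneSpectrum (𝓞 F)) (β : Multiset ℂ), w.asIdeal.under (𝓞 F) = v.asIdeal →
            P.HasSatakeParamAt v β →
              B.HasSatakeParamAt w (β.map (· ^ w.asIdeal.inertiaDeg (𝓞 F)))) →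
        B.IsNearlyEquivalent P' := by
  obtain ⟨P, hP⟩ := h.exists_weakLift F hF π
  obtain ⟨P', hP'⟩ := h.exists_weakLift E hE πE
  exact ⟨P, P', hP, hP', fun B hB ↦
    AutomorphicRepData.isNearlyEquivalent_baseChange_wedgeTwoLift π.1 P πE.1 P' B hP hB hπE hP'⟩

end BaseChange

end Literature.NumberTheory.Automorphic

end
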